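import Mathlib.Analysis.SpecificLimits.Basic
import Summits.Ventures.CertifiedArithmetic.LowPrec.GemmThetaLawE2M1Family
import Summits.Ventures.CertifiedArithmetic.LowPrec.GemmThetaLawGenBinary32
import Summits.Ventures.CertifiedArithmetic.LowPrec.GemmThetaLawE2M1
import Summits.Ventures.CertifiedArithmetic.LowPrec.GemmWorstCaseE2M1
import HarnessLib

/-!
# GEMM worst case L — `W_p(n)` for E2M1² into EVERY precision `p ≥ 8`: the two-sided sandwich
# `θ_p/(n + 25θ_p/2) ≤ 1 - W_p(n) ≤ θ_p/(n - c_p)` and the limit `n(1 - W_p(n)) → θ_p`, kernel-checked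

HONEST FRAMING: certified error envelopes and provably optimal rounding/accumulation schemes for
low-precision formats under stated cost models; every table by two implementations; no hardware or
vendor claims.

`W_φ(n)` (`worstRelErrE2M1 φ (n-1)`) is the largest relative error `|ŝ - s|/Σ|x_i|` of sequential
round-to-nearest-even accumulation in the format `φ` over ALL words of `n` letters from the 37-letter
product alphabet `Π(E2M1,E2M1)` (a finite maximum; at `φ = bfloat16` it is LITERALLY the landed
`worstRelErrE2M1BF16` of `GemmWorstCaseE2M1`, `worstRelErrE2M1_BFloat16`).  For every format `φ`
with `7 ≤ manBits φ` (`p ≥ 8`), `qexp φ ≤ -2` and `2^(manBits φ + 10) ≤ maxRat φ`, with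
`θ_p = thetaP (manBits φ) = 13·2^{p-7} + ¼` and `N = 2^{p-2}`:

* `worstP_le` (SUP side, every `n`): `W_φ(n) ≤ 1 - θ_p/(n + 25θ_p/2)` — the generated law
  certificate `thetaCert_e2m1Law` (`GemmThetaLawGenFinal`, gen 13) through
  `ThetaCertificate.abs_err_le`, with the law's constants in closed form for every `p`
  (`e2m1Law_constants`: `θ = (13·2^m+16)/64 = thetaP m`, `κ = 1/θ`, `ρ = 7/2`, `β = 23/2`);
* `one_sub_worstP_le` (the family of file XLIX, every `n ≥ 13N + 3`):
  `1 - W_φ(n) ≤ 64θ_p/(64n - 691N - 56) = θ_p/(n - c_p)`, `c_p = (691N + 56)/64`;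
* `worstP_sandwich`: both at once — gemm.tex Thm. `t:thetap` (iv) for every `p ≥ 8` with the
  universal-prefix onset `13·2^{p-2} + 3` (the paper's display `16θ_p/(L°_p + 16(n - m°_p))` is the
  same function with the paper's shorter prefix; here `L° = (141N+136)/4`, onset `13N+3`, and
  `16θ_p/(L° + 16(n - 13N - 3)) = θ_p/(n - c_p)` identically);
* `worstP_tendsto` — Thm. `t:thetap` (v) for every `p ≥ 8`: `n·(1 - W_φ(n)) → θ_p` (in `ℝ`, by the
  sandwich);
* `worstP_sandwich_Binary32`: the instance `p = 24` in integers —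
  `13631490/(8n + 170393625) ≤ 1 - W_24(n) ≤ 13631490/(8n - 362283015)` for every
  `n ≥ 54525955`, and `W_24` agrees with gen 12's `abs_dot_err_le_E2M1_Binary32` on the left.

What is NOT claimed: the exact value of `W_p(n)` between the two sides (for `p = 8` it is known for
every `n`, `GemmWorstCaseE2M1` + the certificates of gemm.tex §Regimes; for `p ≥ 9` only the sandwich);
binary16 (`maxRat` too small for the range hypothesis; its law is different, `GemmTerminalBinary16`).
References: [Higham2002, §4.2] (worst cases of recursive summation are format-specific inputs),
[MullerEtAl2018HFPA, §6.1], [BoldoMelquiond2011Flocq] (formal per-format FP error analysis);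
[RouhaniEtAl2023MX, Table 1] (E2M1).
-/

namespace Summit.Ventures.CertifiedArithmetic.LowPrec.Gemm

open Literature.ComputerArithmetic.FloatingPoint
open Literature.ComputerArithmetic.FloatingPoint.MiniFloat
open Literature.ComputerArithmetic.FloatingPoint.MiniFloat.ThetaLaw
open Finset

/-! ### `W_φ(n)` over the product alphabet, any target format -/

/-- `W_φ(n)` for `n = m + 1`: the largest relative error of sequential RNE accumulation in `φ` over
all words of `n` letters from `Π(E2M1,E2M1)`. [cell, gemm.tex §Regimes] -/
def worstRelErrE2M1 (φ : Format) (m : ℕ) : ℚ :=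
  (univ : Finset (Fin (m + 1) → Fin 37)).sup' univ_nonempty (fun w => relErr φ (wordInput w) m)

/-- At `bfloat16` this is literally the landed `worstRelErrE2M1BF16`. [cell, consistency] -/
theorem worstRelErrE2M1_BFloat16 (m : ℕ) :
    worstRelErrE2M1 Format.BFloat16 m = worstRelErrE2M1BF16 m := rfl

/-- Every input over the alphabet is dominated by `W_φ`. [folklore] -/
theorem relErr_le_worstP (φ : Format) (x : ℕ → ℚ) (hx : ∀ j, x j ∈ piE2M1) (m : ℕ) :
    relErr φ x m ≤ worstRelErrE2M1 φ m := by
  classical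
  have hidx : ∀ j, ∃ i : Fin 37, ∀ h : i.val < piE2M1.length, piE2M1[i.val]'h = x j := by
    intro j
    obtain ⟨i, hi, h⟩ := List.getElem_of_mem (hx j)
    exact ⟨⟨i, by simpa [piE2M1_length] using hi⟩, fun _ => h⟩
  choose f hf using hidx
  have hxy : ∀ j ≤ m, x j = wordInput (fun j : Fin (m + 1) => f j.val) j := by
    intro j hj
    unfold wordInput
    rw [dif_pos (by omega)]
    exact (hf j _).symm
  rw [relErr_congr φ hxy]
  exact le_sup' (fun w => relErr φ (wordInput w) m) (mem_univ _)

/-! ### The law's constants for every precision -/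

/-- THE CONSTANTS OF THE E2M1² LAW AT EVERY `m = manBits`: `θ = (13·2^m + 16)/64`,
`κ = 64/(13·2^m + 16) = 1/θ`, `ρ = 7/2`, `β_pair = 23/2`. [cell, gemm.tex Thm. t:thetap (iii)] -/
theorem e2m1Law_constants (mb : ℕ) :
    e2m1Law.thetaL mb = (13 * 2 ^ mb + 16) / 64 ∧ e2m1Law.kappaL mb = 64 / (13 * 2 ^ mb + 16) ∧
    e2m1Law.rhoL = 7 / 2 ∧ e2m1Law.betaL = 23 / 2 := by
  simp only [LawData.thetaL, LawData.kappaL, LawData.rhoL, LawData.betaL, LawData.Bj, LawData.Sj,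
    e2m1Law]
  norm_num

/-- gen 12's `thetaP m = (13·2^{m-1} + 8)/32` in the law's form, `m ≥ 1`. [cell, consistency] -/
theorem thetaP_closed {mb : ℕ} (h : 1 ≤ mb) : thetaP mb = (13 * 2 ^ mb + 16) / 64 := by
  obtain ⟨k, rfl⟩ := Nat.exists_eq_add_of_le' h
  unfold thetaP
  rw [Nat.add_sub_cancel, pow_succ]
  ring

/-- The law's `θ` IS gen 12's `thetaP` (so the two kernel-checked SUP sides agree). [cell] -/
theorem thetaL_eq_thetaP {mb : ℕ} (h : 1 ≤ mb) : e2m1Law.thetaL mb = thetaP mb := by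
  rw [(e2m1Law_constants mb).1, thetaP_closed h]

/-- `κ = 1/θ`. [cell, gemm.tex Thm. t:thetap (iii)] -/
theorem kappaL_eq {mb : ℕ} (h : 1 ≤ mb) : e2m1Law.kappaL mb = 1 / thetaP mb := by
  rw [(e2m1Law_constants mb).2.1, thetaP_closed h, one_div_div]

/-- With `N = 2^{p-2}` (`2^manBits = 2N`): `θ_p = (26N + 16)/64`. [gemm.tex Thm. t:thetap (iii)] -/
theorem thetaP_eq {φ : Format} {N : ℕ} (hM : 2 ^ φ.manBits = 2 * N) :
    thetaP φ.manBits = (26 * (N : ℚ) + 16) / 64 := by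
  have h1 : 1 ≤ φ.manBits := by
    rcases Nat.eq_zero_or_pos φ.manBits with h | h
    · rw [h] at hM; omega
    · exact h
  have hM' : ((2 ^ φ.manBits : ℕ) : ℚ) = ((2 * N : ℕ) : ℚ) := by rw [hM]
  push_cast at hM'
  rw [thetaP_closed h1, hM']
  ring

/-- Letters of `Π(E2M1,E2M1)` are letters of the law. [cell; `mul_mem_PiL_e2m1`] -/
theorem PiL_of_mem_piE2M1 {q : ℚ} (h : q ∈ piE2M1) : e2m1Law.PiL 2 q := by
  obtain ⟨a, b, hab⟩ := exists_mul_eq_of_mem_piE2M1 q h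
  rw [← hab]; exact mul_mem_PiL_e2m1 a b

/-! ### The sandwich -/

/-- SUP SIDE FOR EVERY `p ≥ 8` AND EVERY `n = m + 1` (kernel: the generated law certificate
`thetaCert_e2m1Law`): `W_φ(n) ≤ 1 - θ_p/(n + 25θ_p/2)`. [cell, gemm.tex Thm. t:thetap (iii)] -/
theorem worstP_le (φ : Format) (hm : 7 ≤ φ.manBits) (hq : φ.qexp ≤ -2)
    (hR : (2 : ℚ) ^ (φ.manBits + 10) ≤ φ.maxRat) (m : ℕ) :
    worstRelErrE2M1 φ m ≤ 1 - thetaP φ.manBits / ((m + 1 : ℚ) + 25 / 2 * thetaP φ.manBits) := by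
  have hθ := thetaP_pos φ.manBits
  have h1 : 1 ≤ φ.manBits := le_trans (by norm_num) hm
  apply sup'_le
  intro w _
  unfold relErr
  have hc : (0 : ℚ) ≤ 1 - thetaP φ.manBits / ((m + 1 : ℚ) + 25 / 2 * thetaP φ.manBits) := by
    rw [sub_nonneg, div_le_one (by positivity)]
    linarith [show (0 : ℚ) ≤ m from Nat.cast_nonneg m]
  by_cases hL : ∑ j ∈ range (m + 1), |wordInput w j| = 0
  · rw [hL, div_zero]; exact hc
  · have hpos : 0 < ∑ j ∈ range (m + 1), |wordInput w j| :=
      lt_of_le_of_ne (sum_nonneg fun i _ => abs_nonneg _) (Ne.symm hL)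
    rw [div_le_iff₀ hpos]
    have h := (thetaCert_e2m1Law φ hm hq hR).abs_err_le (fun q hq' => PiL_neg _ _ hq') _
      (fun j => PiL_of_mem_piE2M1 (wordInput_mem w j)) m
    rw [thetaL_eq_thetaP h1, kappaL_eq h1, (e2m1Law_constants φ.manBits).2.2.1,
      (e2m1Law_constants φ.manBits).2.2.2] at h
    have key : (m : ℚ) + thetaP φ.manBits * (1 + (max (7 / 2 : ℚ) (23 / 2) + 1 / thetaP φ.manBits))
        = (m + 1 : ℚ) + 25 / 2 * thetaP φ.manBits := by
      rw [max_eq_right (by norm_num)]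
      field_simp
      ring
    rw [key] at h
    exact h

/-- THE FAMILY SIDE FOR EVERY `n = m + 1 ≥ 13N + 3` (file XLIX, `N = 2^{p-2}`):
`1 - W_φ(n) ≤ (26N + 16)/(64n - 691N - 56) = 64θ_p/(64n - 691N - 56)`.
[cell, gemm.tex Thm. t:thetap (iv)] -/
theorem one_sub_worstP_le (φ : Format) (hq : φ.qexp ≤ -2)
    (hR : (2 : ℚ) ^ (φ.manBits + 10) ≤ φ.maxRat) {N : ℕ} (hM : 2 ^ φ.manBits = 2 * N)
    (m : ℕ) (hmN : 13 * N + 2 ≤ m) :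
    1 - worstRelErrE2M1 φ m ≤ (26 * (N : ℚ) + 16) / (64 * ((m : ℚ) + 1) - 691 * N - 56) := by
  have hw := relErr_le_worstP φ (fam N) (fam_mem N) m
  have hd := fam_defect hq hR hM m hmN
  unfold relErr at hw
  linarith

/-- THE TWO-SIDED SANDWICH FOR EVERY PRECISION `p ≥ 8` AND EVERY `n ≥ 13·2^{p-2} + 3`
(`n = m + 1`, `N = 2^{p-2}`, `θ_p = 13·2^{p-7} + ¼ = (26N + 16)/64`):
`θ_p/(n + 25θ_p/2) ≤ 1 - W_p(n) ≤ θ_p/(n - (691N + 56)/64)`, both sides kernel-checked.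
[cell, gemm.tex Thm. t:thetap (iv)] -/
theorem worstP_sandwich (φ : Format) (hm : 7 ≤ φ.manBits) (hq : φ.qexp ≤ -2)
    (hR : (2 : ℚ) ^ (φ.manBits + 10) ≤ φ.maxRat) {N : ℕ} (hM : 2 ^ φ.manBits = 2 * N)
    (m : ℕ) (hmN : 13 * N + 2 ≤ m) :
    thetaP φ.manBits / ((m + 1 : ℚ) + 25 / 2 * thetaP φ.manBits) ≤ 1 - worstRelErrE2M1 φ m ∧
      1 - worstRelErrE2M1 φ m ≤ thetaP φ.manBits / ((m + 1 : ℚ) - (691 * N + 56) / 64) := by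
  refine ⟨by linarith [worstP_le φ hm hq hR m], ?_⟩
  have h := one_sub_worstP_le φ hq hR hM m hmN
  have eB : (m + 1 : ℚ) - (691 * N + 56) / 64 = (64 * ((m : ℚ) + 1) - 691 * N - 56) / 64 := by ring
  rw [thetaP_eq hM, eB, div_div_div_cancel_right₀ (by norm_num : (64 : ℚ) ≠ 0)]
  exact h

/-- THE LIMIT, EVERY PRECISION `p ≥ 8`: `n · (1 - W_p(n)) → θ_p` as `n → ∞` (squeezed between
the two sides of `worstP_sandwich`). [cell, gemm.tex Thm. t:thetap (v)] -/
theorem worstP_tendsto (φ : Format) (hm : 7 ≤ φ.manBits) (hq : φ.qexp ≤ -2)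
    (hR : (2 : ℚ) ^ (φ.manBits + 10) ≤ φ.maxRat) :
    Filter.Tendsto (fun m : ℕ => ((m : ℝ) + 1) * (1 - (worstRelErrE2M1 φ m : ℝ))) Filter.atTop
      (nhds (thetaP φ.manBits : ℝ)) := by
  obtain ⟨N, hM⟩ : ∃ N, 2 ^ φ.manBits = 2 * N :=
    ⟨2 ^ (φ.manBits - 1), by rw [← pow_succ', Nat.sub_add_cancel (le_trans (by norm_num) hm)]⟩
  have hlim0 : Filter.Tendsto (fun m : ℕ => 1 / ((m : ℝ) + 1)) Filter.atTop (nhds 0) :=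
    tendsto_one_div_add_atTop_nhds_zero_nat
  -- the two bounding sequences, written as functions of `1/(m+1)`, and their common limit `θ`
  have hg : Filter.Tendsto (fun m : ℕ =>
      (thetaP φ.manBits : ℝ) / (1 + 25 / 2 * (thetaP φ.manBits : ℝ) * (1 / ((m : ℝ) + 1))))
      Filter.atTop (nhds (thetaP φ.manBits : ℝ)) := by
    have h : Filter.Tendsto (fun m : ℕ =>
        (thetaP φ.manBits : ℝ) / (1 + 25 / 2 * (thetaP φ.manBits : ℝ) * (1 / ((m : ℝ) + 1))))
        Filter.atTop (nhds ((thetaP φ.manBits : ℝ) / (1 + 25 / 2 * (thetaP φ.manBits : ℝ) * 0))) :=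
      tendsto_const_nhds.div (tendsto_const_nhds.add (tendsto_const_nhds.mul hlim0))
        (by norm_num)
    rw [mul_zero, add_zero, div_one] at h
    exact h
  have hh : Filter.Tendsto (fun m : ℕ =>
      (thetaP φ.manBits : ℝ) / (1 - (691 * (N : ℝ) + 56) / 64 * (1 / ((m : ℝ) + 1))))
      Filter.atTop (nhds (thetaP φ.manBits : ℝ)) := by
    have h : Filter.Tendsto (fun m : ℕ =>
        (thetaP φ.manBits : ℝ) / (1 - (691 * (N : ℝ) + 56) / 64 * (1 / ((m : ℝ) + 1))))
        Filter.atTop (nhds ((thetaP φ.manBits : ℝ) / (1 - (691 * (N : ℝ) + 56) / 64 * 0))) :=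
      tendsto_const_nhds.div (tendsto_const_nhds.sub (tendsto_const_nhds.mul hlim0))
        (by norm_num)
    rw [mul_zero, sub_zero, div_one] at h
    exact h
  refine tendsto_of_tendsto_of_tendsto_of_le_of_le' hg hh ?_ ?_
  · refine Filter.eventually_atTop.2 ⟨13 * N + 2, fun m hmN => ?_⟩
    have hr1 := (Rat.cast_le (K := ℝ)).mpr (worstP_sandwich φ hm hq hR hM m hmN).1
    push_cast at hr1
    have hm0 : (0 : ℝ) < (m : ℝ) + 1 := by positivity
    have hm1 : (m : ℝ) + 1 ≠ 0 := hm0.ne'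
    have e1 : 1 + 25 / 2 * (thetaP φ.manBits : ℝ) * (1 / ((m : ℝ) + 1))
        = (((m : ℝ) + 1) + 25 / 2 * (thetaP φ.manBits : ℝ)) / ((m : ℝ) + 1) := by
      rw [eq_div_iff hm1, add_mul, one_mul, mul_assoc, one_div_mul_cancel hm1, mul_one]
    show (thetaP φ.manBits : ℝ) / (1 + 25 / 2 * (thetaP φ.manBits : ℝ) * (1 / ((m : ℝ) + 1)))
      ≤ ((m : ℝ) + 1) * (1 - (worstRelErrE2M1 φ m : ℝ))
    rw [e1, div_div_eq_mul_div]
    calc (thetaP φ.manBits : ℝ) * ((m : ℝ) + 1) / (((m : ℝ) + 1) + 25 / 2 * (thetaP φ.manBits : ℝ))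
        = ((m : ℝ) + 1) * ((thetaP φ.manBits : ℝ) / (((m : ℝ) + 1) + 25 / 2 * (thetaP φ.manBits : ℝ))) := by
          ring
      _ ≤ ((m : ℝ) + 1) * (1 - (worstRelErrE2M1 φ m : ℝ)) := mul_le_mul_of_nonneg_left hr1 hm0.le
  · refine Filter.eventually_atTop.2 ⟨13 * N + 2, fun m hmN => ?_⟩
    have hr2 := (Rat.cast_le (K := ℝ)).mpr (worstP_sandwich φ hm hq hR hM m hmN).2
    push_cast at hr2
    have hm0 : (0 : ℝ) < (m : ℝ) + 1 := by positivity
    have hm1 : (m : ℝ) + 1 ≠ 0 := hm0.ne'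
    have e1 : 1 - (691 * (N : ℝ) + 56) / 64 * (1 / ((m : ℝ) + 1))
        = (((m : ℝ) + 1) - (691 * (N : ℝ) + 56) / 64) / ((m : ℝ) + 1) := by
      rw [eq_div_iff hm1, sub_mul, one_mul, mul_assoc, one_div_mul_cancel hm1, mul_one]
    show ((m : ℝ) + 1) * (1 - (worstRelErrE2M1 φ m : ℝ))
      ≤ (thetaP φ.manBits : ℝ) / (1 - (691 * (N : ℝ) + 56) / 64 * (1 / ((m : ℝ) + 1)))
    rw [e1, div_div_eq_mul_div]
    calc ((m : ℝ) + 1) * (1 - (worstRelErrE2M1 φ m : ℝ))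
        ≤ ((m : ℝ) + 1) * ((thetaP φ.manBits : ℝ) / (((m : ℝ) + 1) - (691 * (N : ℝ) + 56) / 64)) :=
          mul_le_mul_of_nonneg_left hr2 hm0.le
      _ = (thetaP φ.manBits : ℝ) * ((m : ℝ) + 1) / (((m : ℝ) + 1) - (691 * (N : ℝ) + 56) / 64) := by
          ring

/-! ### The instance `p = 24` (binary32) in integers -/

/-- binary32 meets the hypotheses, with `N = 2^22 = 4194304`. [cite: IEEE7542019, Table 3.5] -/
theorem Binary32_hyps : 7 ≤ Format.Binary32.manBits ∧ Format.Binary32.qexp ≤ -2 ∧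
    (2 : ℚ) ^ (Format.Binary32.manBits + 10) ≤ Format.Binary32.maxRat ∧
    2 ^ Format.Binary32.manBits = 2 * 4194304 := by
  obtain ⟨h1, h2, h3⟩ := Binary32_gen_hyps
  refine ⟨by rw [h1]; norm_num, le_trans h2 (by norm_num), le_trans ?_ h3, by rw [h1]; norm_num⟩
  rw [h1]; norm_num

/-- E2M1² INTO binary32, EVERY `n ≥ 54525955 = 13·2^22 + 3`:
`13631490/(8n + 170393625) ≤ 1 - W_24(n) ≤ 13631490/(8n - 362283015)`; the left side holds
for every `n` (it is gen 12's envelope `abs_dot_err_le_E2M1_Binary32`), the right side is the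
family; `θ_24 = 13·2^17 + ¼` and `n(1 - W_24(n)) → θ_24`. [cell, gemm.tex Thm. t:thetap at p = 24] -/
theorem worstP_sandwich_Binary32 (m : ℕ) (hm : 54525954 ≤ m) :
    13631490 / (8 * ((m : ℚ) + 1) + 170393625) ≤ 1 - worstRelErrE2M1 Format.Binary32 m ∧
      1 - worstRelErrE2M1 Format.Binary32 m ≤ 13631490 / (8 * ((m : ℚ) + 1) - 362283015) := by
  obtain ⟨h1, h2, h3, h4⟩ := Binary32_hyps
  have h := worstP_sandwich Format.Binary32 h1 h2 h3 h4 m (by omega)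
  rw [thetaP_Binary32] at h
  have hm' : (54525954 : ℚ) ≤ m := by exact_mod_cast hm
  have e1 : (13 * 2 ^ 17 + 1 / 4 : ℚ) / ((m + 1 : ℚ) + 25 / 2 * (13 * 2 ^ 17 + 1 / 4))
      = 13631490 / (8 * ((m : ℚ) + 1) + 170393625) := by
    rw [div_eq_div_iff (by positivity) (by positivity)]; ring
  have e2 : (13 * 2 ^ 17 + 1 / 4 : ℚ) / ((m + 1 : ℚ) - (691 * ((4194304 : ℕ) : ℚ) + 56) / 64)
      = 13631490 / (8 * ((m : ℚ) + 1) - 362283015) := by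
    rw [div_eq_div_iff (ne_of_gt (by push_cast; linarith)) (ne_of_gt (by linarith))]
    push_cast; ring
  rw [e1, e2] at h
  exact h

end Summit.Ventures.CertifiedArithmetic.LowPrec.Gemm
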